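import Literature.RingTheory.KrullDimension.HomogeneousHeightZero
import Literature.RingTheory.MvPolynomial.HomogeneousDimension
import Mathlib.Analysis.Complex.Polynomial.Basic

/-!
# Route BarrierLever — a cone of projective dimension `≥ 1` meets every coordinate hyperplane
# (tool for the `dc ≤ n + k` rung of crux `DefinableDcEquations`, stmt-ValiantsHypothesis-8746)

Support file for the Kumar–Volk-type ("degree trading") sharpening of
`BarrierLeverDefinableDcEquationsConstantExcess.lean`.  The passage "from an affine singular locus
of positive dimension to a singular point AT INFINITY of the top form" is done in the tree's
vocabulary of heights of homogeneous primes: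

* `exists_ne_zero_coord_eq_zero_of_isPrime` — if `𝔭 ⊂ ℂ[X_0, …, X_{N-1}]` is a homogeneous prime
  NOT containing the variable `X_j` and `height 𝔭 + 1 < N`, then `V(𝔭)` has a point `ξ ≠ 0` with
  `ξ_j = 0`.  Proof: a minimal prime `P` of `𝔭 + (X_j)` has `dim S/P + 1 = dim S/𝔭` (the tree's
  `ringKrullDim_quotient_add_one_of_mem_minimalPrimes_sup_span`: Krull's principal ideal theorem
  + the catenary dimension formula `ringKrullDim_quotient_add_height`), so
  `height (𝔭 + (X_j)) ≤ height 𝔭 + 1 < N`, and a homogeneous ideal of height `< N` has a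
  nonzero zero (`exists_ne_zero_common_zero_of_isHomogeneous_of_height_lt`).
* `exists_ne_zero_none_eq_zero_of_isPrime` — the same in the coordinates
  `ℂ[X_none, X_(some i)] = MvPolynomial (Option (Fin w)) ℂ` of the tree's homogenization API
  (`IdealHomogenization.lean`), the distinguished variable being `X none` (transport along
  `finSuccEquiv`).

Nothing here bears on `VP` vs `VNP`.  No definitions, no named-fact hypotheses; standard axioms.

References: H. Matsumura, *Commutative Ring Theory*, Thm. 13.5 (Krull) and Thm. 5.6 (dimension
formula) [Matsumura1987]; R. Hartshorne, *Algebraic Geometry*, I Thm. 7.2 [Hartshorne1977].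
-/

-- layout Summits/ValiantsHypothesis/ValiantsHypothesis forces the duplicated namespace component
set_option linter.dupNamespace false

noncomputable section

open MvPolynomial

namespace Summit.ValiantsHypothesis.ValiantsHypothesis.Theorems.BarrierLever.DcConstantExcess

open Literature.RingTheory.KrullDimension
open Literature.RingTheory.MvPolynomial

/-- **A homogeneous prime cone of projective dimension `≥ 1` meets the hyperplane `X_j = 0`.**
If `𝔭 ⊂ ℂ[X_0, …, X_{N-1}]` is a homogeneous prime with `X_j ∉ 𝔭` and `height 𝔭 + 1 < N`, then
there is `ξ ≠ 0` with `ξ_j = 0` on which every element of `𝔭` vanishes (Krull's principal ideal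
theorem and the catenary dimension formula give `height (𝔭 + (X_j)) = height 𝔭 + 1 < N`; then
the tree's `exists_ne_zero_common_zero_of_isHomogeneous_of_height_lt`).
[cite: Matsumura1987, Thm. 13.5 and Thm. 5.6] -/
theorem exists_ne_zero_coord_eq_zero_of_isPrime {N : ℕ} {𝔭 : Ideal (MvPolynomial (Fin N) ℂ)}
    [h𝔭p : 𝔭.IsPrime]
    (h𝔭 : letI : GradedAlgebra (homogeneousSubmodule (Fin N) ℂ) := MvPolynomial.gradedAlgebra
      𝔭.IsHomogeneous (homogeneousSubmodule (Fin N) ℂ))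
    (j : Fin N) (hj : (X j : MvPolynomial (Fin N) ℂ) ∉ 𝔭) (hlt : 𝔭.height + 1 < N) :
    ∃ ξ : Fin N → ℂ, ξ ≠ 0 ∧ ξ j = 0 ∧ ∀ p ∈ 𝔭, eval ξ p = 0 := by
  classical
  letI : GradedAlgebra (homogeneousSubmodule (Fin N) ℂ) := MvPolynomial.gradedAlgebra
  set I : Ideal (MvPolynomial (Fin N) ℂ) := 𝔭 ⊔ Ideal.span {(X j : MvPolynomial (Fin N) ℂ)}
    with hIdef
  -- `I` is homogeneous and proper
  have hXhom : (Ideal.span {(X j : MvPolynomial (Fin N) ℂ)}).IsHomogeneous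
      (homogeneousSubmodule (Fin N) ℂ) := by
    refine Ideal.homogeneous_span (𝒜 := homogeneousSubmodule (Fin N) ℂ) _ ?_
    intro x hx
    rw [Set.mem_singleton_iff.1 hx]
    exact ⟨1, (mem_homogeneousSubmodule 1 _).2 (isHomogeneous_X ℂ j)⟩
  have hIhom : I.IsHomogeneous (homogeneousSubmodule (Fin N) ℂ) := Ideal.IsHomogeneous.sup h𝔭 hXhom
  set m₀ : Ideal (MvPolynomial (Fin N) ℂ) :=
    RingHom.ker (constantCoeff : MvPolynomial (Fin N) ℂ →+* ℂ) with hm₀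
  have hIle : I ≤ m₀ := by
    refine sup_le (le_ker_constantCoeff_of_isHomogeneous h𝔭 h𝔭p.ne_top) ?_
    rw [Ideal.span_le, Set.singleton_subset_iff, SetLike.mem_coe, hm₀, RingHom.mem_ker,
      constantCoeff_X]
  have hItop : I ≠ ⊤ := fun h =>
    (isMaximal_ker_constantCoeff (σ := Fin N) (K := ℂ)).ne_top (top_le_iff.1 (h ▸ hIle))
  -- a minimal prime `P` of `I`; its height is `height 𝔭 + 1`
  obtain ⟨P, hP⟩ := Ideal.nonempty_minimalPrimes hItop
  haveI hPp : P.IsPrime := hP.1.1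
  have hcut := ringKrullDim_quotient_add_one_of_mem_minimalPrimes_sup_span (K := ℂ) hj hP
  obtain ⟨d𝔭, hd𝔭, -⟩ := exists_nat_ringKrullDim_quotient_eq (K := ℂ) h𝔭p.ne_top
  obtain ⟨dP, hdP, -⟩ := exists_nat_ringKrullDim_quotient_eq (K := ℂ) hPp.ne_top
  have h1 : dP + 1 = d𝔭 := by
    rw [hd𝔭, hdP] at hcut
    exact_mod_cast hcut
  have hdim𝔭 := ringKrullDim_quotient_add_height (F := ℂ) (A := MvPolynomial (Fin N) ℂ) 𝔭
  have hdimP := ringKrullDim_quotient_add_height (F := ℂ) (A := MvPolynomial (Fin N) ℂ) P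
  rw [ringKrullDim_mvPolynomial_fin] at hdim𝔭 hdimP
  obtain ⟨a, ha⟩ := ENat.ne_top_iff_exists.1 (Ideal.height_ne_top_of_isPrime (I := 𝔭))
  obtain ⟨b, hb⟩ := ENat.ne_top_iff_exists.1 (Ideal.height_ne_top_of_isPrime (I := P))
  rw [hd𝔭, ← ha] at hdim𝔭
  rw [hdP, ← hb] at hdimP
  have h2 : d𝔭 + a = N := by exact_mod_cast hdim𝔭
  have h3 : dP + b = N := by exact_mod_cast hdimP
  have hb' : b = a + 1 := by omega
  -- hence `height I ≤ height P = height 𝔭 + 1 < N`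
  have hIlt : I.height < N := by
    refine lt_of_le_of_lt (Ideal.height_mono hP.1.2) ?_
    rw [← hb, hb']
    rw [← ha] at hlt
    exact_mod_cast (show a + 1 < N by exact_mod_cast hlt)
  obtain ⟨ξ, hξ0, hξ⟩ := exists_ne_zero_common_zero_of_isHomogeneous_of_height_lt I hIhom hIlt
  refine ⟨ξ, hξ0, ?_, fun p hp => hξ p (Ideal.mem_sup_left hp)⟩
  have h := hξ (X j) (Ideal.mem_sup_right (Ideal.mem_span_singleton_self _))
  rwa [eval_X] at h

/-- **The same in the homogenization coordinates `MvPolynomial (Option (Fin w)) ℂ`** (variable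
`X none` = the homogenizing variable `x₀` of the tree's `IdealHomogenization.lean`): a homogeneous
prime `𝔭` with `X none ∉ 𝔭` and `height 𝔭 < w` has a zero `ξ ≠ 0` with `ξ none = 0`, i.e. a
nonzero zero `ξ ∘ some` "at infinity" (transport along `finSuccEquiv w : Fin (w+1) ≃ Option (Fin w)`).
[cite: Matsumura1987, Thm. 13.5 and Thm. 5.6] -/
theorem exists_ne_zero_none_eq_zero_of_isPrime {w : ℕ} {𝔭 : Ideal (MvPolynomial (Option (Fin w)) ℂ)}
    [h𝔭p : 𝔭.IsPrime]
    (h𝔭 : letI : GradedAlgebra (homogeneousSubmodule (Option (Fin w)) ℂ) := MvPolynomial.gradedAlgebra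
      𝔭.IsHomogeneous (homogeneousSubmodule (Option (Fin w)) ℂ))
    (hX : (X none : MvPolynomial (Option (Fin w)) ℂ) ∉ 𝔭) (hlt : 𝔭.height < w) :
    ∃ ξ : Option (Fin w) → ℂ, ξ ∘ some ≠ 0 ∧ ξ none = 0 ∧ ∀ p ∈ 𝔭, eval ξ p = 0 := by
  classical
  letI : GradedAlgebra (homogeneousSubmodule (Option (Fin w)) ℂ) := MvPolynomial.gradedAlgebra
  letI : GradedAlgebra (homogeneousSubmodule (Fin (w + 1)) ℂ) := MvPolynomial.gradedAlgebra
  let e : Option (Fin w) ≃ Fin (w + 1) := (finSuccEquiv w).symm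
  let φ : MvPolynomial (Option (Fin w)) ℂ ≃ₐ[ℂ] MvPolynomial (Fin (w + 1)) ℂ := renameEquiv ℂ e
  set 𝔭' : Ideal (MvPolynomial (Fin (w + 1)) ℂ) := 𝔭.map (φ : MvPolynomial (Option (Fin w)) ℂ →+*
    MvPolynomial (Fin (w + 1)) ℂ) with h𝔭'def
  have hmem : ∀ x, x ∈ 𝔭' ↔ φ.symm x ∈ 𝔭 := fun x => by
    rw [h𝔭'def, show (φ : MvPolynomial (Option (Fin w)) ℂ →+* MvPolynomial (Fin (w + 1)) ℂ) =
      ((φ : MvPolynomial (Option (Fin w)) ℂ ≃+* MvPolynomial (Fin (w + 1)) ℂ) : _ →+* _) from rfl,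
      Ideal.map_comap_of_equiv, Ideal.mem_comap]
    rfl
  haveI h𝔭'p : 𝔭'.IsPrime :=
    Ideal.map_isPrime_of_equiv (φ : MvPolynomial (Option (Fin w)) ℂ ≃+* MvPolynomial (Fin (w + 1)) ℂ)
  -- homogeneity transports along the renaming
  have h𝔭'hom : 𝔭'.IsHomogeneous (homogeneousSubmodule (Fin (w + 1)) ℂ) := by
    obtain ⟨T, hT⟩ := (Ideal.IsHomogeneous.iff_exists (𝒜 := homogeneousSubmodule (Option (Fin w)) ℂ)
      𝔭).1 h𝔭
    rw [h𝔭'def, hT, Ideal.map_span]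
    refine Ideal.homogeneous_span (𝒜 := homogeneousSubmodule (Fin (w + 1)) ℂ) _ ?_
    rintro _ ⟨x, ⟨t, ht, rfl⟩, rfl⟩
    obtain ⟨d, hd⟩ := t.2
    exact ⟨d, (mem_homogeneousSubmodule d _).2
      (((mem_homogeneousSubmodule d _).1 hd).rename_isHomogeneous (f := e))⟩
  have hX' : (X 0 : MvPolynomial (Fin (w + 1)) ℂ) ∉ 𝔭' := by
    rw [hmem]
    have : φ.symm (X 0) = X none := by
      show rename e.symm (X 0) = X none
      rw [rename_X]
      simp [e]
    rwa [this]
  have hlt' : 𝔭'.height + 1 < w + 1 := by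
    have hh : 𝔭'.height = 𝔭.height := by
      rw [h𝔭'def]
      exact RingEquiv.height_map (φ : MvPolynomial (Option (Fin w)) ℂ ≃+* MvPolynomial (Fin (w + 1)) ℂ) 𝔭
    rw [hh]
    obtain ⟨a, ha⟩ := ENat.ne_top_iff_exists.1 (Ideal.height_ne_top_of_isPrime (I := 𝔭))
    rw [← ha] at hlt ⊢
    exact_mod_cast (show a + 1 < w + 1 by
      have : a < w := by exact_mod_cast hlt
      omega)
  obtain ⟨ξ', hξ'0, hξ'j, hξ'⟩ := exists_ne_zero_coord_eq_zero_of_isPrime h𝔭'hom 0 hX' hlt'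
  refine ⟨ξ' ∘ e, ?_, ?_, fun p hp => ?_⟩
  · intro h0
    apply hξ'0
    funext i
    rcases Fin.eq_zero_or_eq_succ i with rfl | ⟨i', rfl⟩
    · exact hξ'j
    · have := congrFun h0 i'
      simpa [e] using this
  · show ξ' (e none) = 0
    simpa [e] using hξ'j
  · have h := hξ' (φ p) ((hmem _).2 (by simpa using hp))
    change eval ξ' (rename e p) = 0 at h
    rwa [eval_rename] at h

end Summit.ValiantsHypothesis.ValiantsHypothesis.Theorems.BarrierLever.DcConstantExcess

end
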